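import Literature.MathematicalPhysics.QuantumFieldTheory.Balaban1983to89.B9Eq3105RestAtMember
import Literature.MathematicalPhysics.QuantumFieldTheory.Balaban1983to89.B9Eq3105RestTAtMember
import Literature.MathematicalPhysics.QuantumFieldTheory.Balaban1983to89.B9Thm310DeltaAIsUnitOfExpansion
import Literature.MathematicalPhysics.QuantumFieldTheory.Balaban1983to89.B9GeoInputsMultiRateKLevelV1
import Literature.MathematicalPhysics.QuantumFieldTheory.Balaban1983to89.B9CoReadingCoords
import Literature.MathematicalPhysics.QuantumFieldTheory.Balaban1983to89.B9Thm37GpAtCoverLarge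

/-!
# `Balaban1983to89.B9Thm310DeltaAAtMemberOfCubeData` — THEOREM 3.10 ⇒ THEOREM 3.3 AT THE MEMBER FROM CUBE DATA: the bond-sector MEMBER ASSEMBLER
# (file ASM2, the last file of the ASSEMBLER ROAD; cell `lit-balaban`, seat p38 gen 49, plan p33 gen 105 `ASM2-PLAN.md`)

T. Bałaban, *Propagators for lattice gauge theories in a background field*, Commun. Math. Phys. **99** (1985) 389–434 [`Balaban1985BackgroundPropagators`,
"[B9]"]: Thm 3.3 p. 399 (the propagator `G(U) = Δ_a(U)⁻¹` of (3.27) p. 395 satisfies (3.42) p. 397) via Thm 3.10 pp. 414–416, (3.105)–(3.106) p. 414 «Δ_aG₀ = I − R», «More exactly, it will follow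
from this analysis that R satisfies the bound (3.85) with O(M⁻¹) instead of O(α₁). For M sufficiently large this implies G = G₀(I − R)⁻¹ = Σ_{n=0}^∞ G₀Rⁿ.
(3.106)», p. 416 (after (3.108)) «This implies Theorem 3.3.»; Cor. 3.6 p. 408 (the per-cube (3.35) data), (3.35)–(3.37) p. 396, (3.69) p. 404 (plaquette variables of
the background near 1).  [4] = [`Balaban1984PropagatorsII`] Lemma 2.1 (2.60)–(2.63) p. 234, Prop. 2.2 (2.65)–(2.67) p. 234.

statement-level skeleton of published theorems with citation tags; proofs where landed; nothing here is a claim about the Yang–Mills mass gap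

WHY THIS FILE (scope memos `run/shared/lean/pub/lit-balaban/lit-balaban-p33/g105/ASSEMBLER-SCOPE.md`, `ASM2-PLAN.md`).  The torus Thm 2 cover form
`B8Thm2TorusCoverOfDeltaAAssembler.hThm2Cover_of_prop6_deltaAAssembler` (t2s-1 gen 17, p700891) displays ONE hypothesis, the BOND-SECTOR MEMBER ASSEMBLER:
member-free constants `δ_A > 0`, `K_A ≥ 0`, thresholds `M₀ T₀ N₀`, a (3.37) size `a₁ > 0`, a plaquette window `δh₀ > 0`, and then, at every member above the
thresholds with `c_f = L^k`, every section `ιB`, every unitary-valued `U` with the (3.69)-type plaquette datum and every family of per-cube (3.35) data obeying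
the twelve clauses of Cor. 3.6: (1ₛ) `IsUnit Δ_a(U; parSymY)` and (Eₛ) the (3.42) block `EBlock (kernelFamilyBInv i B cfg (GAY i parSymY parBY G′) par) K_A δ_A U₁`
for every background family through `U`.  THIS FILE PROVES IT: module M5.7's endpoint (`B9Thm310DeltaAIsUnitOfExpansion.eBlock_kernelFamilyBInv_GAY_of_localInverseCubes''`
∕ `isUnit_deltaAY_of_localInverse`, p. 414 «For M sufficiently large this implies G = G₀(I − R)⁻¹») is fed, at the located letters of record at the hermitian
representative `Aʰ_□ = ½(A_□ + A_□⋆)`, with the two halves of the (3.105) remainder assembled by p33 gen 105 — ASM1-R `B9Eq3105RestAtMember.rest_at_member`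
(laws `hP1`∕`hdef`∕`hdefT`, cube-letter blocks `hE`, bi-contractivity, `IsUnit Δ′_a`, `hrest ≺ K_R·M_h⁻¹·e^{−δ_R d}`) and ASM1-V `B9Eq3105RestTAtMember.restT_at_member`
(`hV′ ≺ K_V·M_h⁻¹·ℓ(a)ℓ(a′)⁻¹e^{−δ_V d}`) — at the common rate `δ₀ = min(δ_R, δ_V)`, `α = ¼`, [4] Lemma 2.1 ∕ (2.63) above one threshold
(`B9GeoInputsMultiRateKLevelV1.geo_inputs3_geo9K`), `η = |c_f|⁻¹` (`B9Cor36GpCoverBindersUnitary.etaS_eq_kGeo_eta_of_cf`), the plaquette datum weakened to the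
window `δh₀ = 1`; the two LOCATED SMALLNESS conditions («M sufficiently large») hold with value `≤ ½` above a threshold on `L·M_h` because every member-dependent
size is `O(M_h⁻¹)`, and the endpoint's member-dependent (3.42) constant is bounded by the member-free `K_A` (§0, the `B9Thm37GpAtCoverLarge` §1 pattern, its `frac_le_two` ∕ `inv_small` by name).

WHAT THIS FILE PROVES (theorems only; 0 `def`, 0 `def … : Prop`, 0 sorry; standard axioms).
* §0 arithmetic of «M sufficiently large»: ★ `member_constant_le_deltaA` (the M5.7 endpoint's constant at `M_h = m ≥ 1` above the two thresholds is `≤ K_A`,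
  with both located smallness quantities `≤ ½`; `frac_le_two` ∕ `inv_small` ∕ `geo9K_M_eq'` of `B9Thm37GpAtCoverLarge` §1 USED BY NAME).
* §1 ★★★ `deltaA_at_member_of_cubeData` — THE MEMBER ASSEMBLER for the unitary matrix fibre `M_N(ℂ)`, every `d`, `0 < b₀ ≤ b₁`: `∃ δ_A K_A M₀ T₀ N₀ a₁ δh₀`, for
  every member above the thresholds … (1ₛ) ∧ (Eₛ) — EXACTLY the binder list of the hypothesis of `hThm2Cover_of_prop6_deltaAAssembler` (there `d = 2`, `N = 2`,
  `b₀ = b₁ = 1`), so the sub-row's LAST JUNCTION is one application.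
* §2 ★★★ `deltaA_at_member_of_cubeData_two` — §1 at `d = 2`, `N = 2`, `b₀ = b₁ = 1` in the letter of the consumer (kernel-checked shape certificate).

HONEST SCOPE.  Pure assembly of landed theorems and elementary real arithmetic; no estimate of print is added or removed.  The located letters, the defect
family ((R)-design, NOT in print; `= 0` for print's exact local inverses) and the hermitian representative are those of ASM1-R ∕ ASM1-V; the per-cube (3.35)
data, the plaquette datum, [B8] Prop. 6 and the regime (1.7) stay the CONSUMER's (they are discharged inside `hThm2Cover_of_prop6_deltaAAssembler`).  What (1ₛ)
∧ (Eₛ) say: invertibility of def-Y's `Δ_a(U) = deltaAY i parSymY parBY G′(U)` and the (3.42) random-walk block of its inverse reading — [B9] Thm 3.3 for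
`G = Δ_a⁻¹` AT THE MEMBER, in the cell's (3.42) currency `EBlock`; nothing about positivity.  Count-neutral; `stub_PV3A` NOT discharged here; no summit ∕ node
statement proved; nothing continuum ∕ ℝ⁴ ∕ OS ∕ Clay — the Yang–Mills mass gap is NOT proved by any of this (Track A conditional rung).
`--supports stmt-QuantumFields-19200`.  RELATED, NOT DUPLICATED (searched 2026-08-29: `lean search 'deltaA_at_member|DeltaAAtMember|AtMemberOfCubeData' --decl`
— only p21's `B9Thm32CinvAtMemberOfCubeData*` (the `C`-member, a different operator); `rg -l "localInverseCubes''"` over Literature = suppliers ∕ the t2s-1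
signature file only — no member-level caller of the M5.7 endpoint exists).
-/

noncomputable section

open scoped BigOperators Matrix Matrix.Norms.L2Operator

namespace Literature.MathematicalPhysics.QuantumFieldTheory.Balaban1983to89.B9Thm310DeltaAAtMemberOfCubeData

open NormedSpace Complex
open B6RandomWalk (HasMajorant Ineq261 Ineq263 hasMajorant_mono hasMajorant_add c1_nonneg)
open B9Thm34Ext (toB6)
open B9FromB6 (EBlock)
open B9Eq352DivFormLetters (conj)
open B6KLevelCensusIndexV1 (KIdx kGeo)
open B6Cover236MultiLevelBlocks (cubes)
open B6GlobalChartV1 (PV boxEquiv blkV1)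
open B6Ineq2142KLevelV1 (β)
open B9GeoNormsKLevelV1 (geo9K)
open B9BackgroundsKLevelV1 (shiftsV1)
open B9Eq39Adjoint (fluct covD)
open B9Eq360DeltaPrimeAY (AfldY)
open B9CubeGeometryInputs (RM1)
open B9CubeLettersInvReadings (kernelFamilyBInv)
open B9Thm37CubeCoverCommutators (cutMulY hTY)
open B4PartitionUnity22 (thetaProf D1)
open B9Cor36CubeCutoffs (SC NearC chiY locCfgY)
open B9Eq3104CutoffCommutators (hBdY DPDsY deltaLocY)
open B9Eq3105ZetaY (zetaY zetaY_eq_one_of_hTY_ne_zero)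
open B9Cor36GCubeLocLetter (locLetterBY locProjBY locP1BY locDefectBY locDefectTBY)
open B6Partition118KLevelFineSizes (C1F C1F_nonneg)
open B6Partition118KLevelFineSecond (C2F C2F_nonneg)
open B6Partition118KLevelFineMixed (C2X C2X_bounds)
open B6Partition118KLevelTorusBinders (sLipT sLipT_nonneg)
open B9Thm310CommutatorBound389B (theta389B theta389B_nonneg)
open B9Thm310DeltaAIsUnitOfExpansion (eBlock_kernelFamilyBInv_GAY_of_localInverseCubes'' isUnit_deltaAY_of_localInverse)
open B9GeoInputsMultiRateKLevelV1 (geo_inputs3_geo9K)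
open B9CoReadingCoords (cdBₗ cdsBₗ lapBₗ lapBₗ_apply)
open B9Eq3105RestAtMember (rest_at_member eBlock_rate_mono)
open B9Thm37GpAtCoverLarge (frac_le_two inv_small geo9K_M_eq')
open B9Eq3105RestTAtMember (restT_at_member)
open B9Cor36GpCoverBindersUnitary (etaS_eq_kGeo_eta_of_cf)
open B7Prop2Explicit (unitaryUnits)
open Node00 (SiteY BlkY IBondY FBondY CfgY GaugeY SiteOpY BondOpY SiteParY BondParY toKT GpY deltaAY GAY gaugeY parSymY parBY etaS qT holY levY PlaqY)
open Node00.OpsYNablaBridge (chartY)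

variable {d ℓ : ℕ} {hd : 1 ≤ d + 1} {hL : Odd (ℓ + 1) ∧ 1 < ℓ + 1} {b₀ b₁ : ℝ}
variable {ι : Type} [Fintype ι]

/-! ## §0 Arithmetic of «M sufficiently large» (the `B9Thm37GpAtCoverLarge` §1 pattern — `frac_le_two`, `inv_small` by name — for the M5.7 endpoint's constant) -/


/-- ★ **THE M5.7 ENDPOINT's (3.42) CONSTANT AT A MEMBER IS AT MOST THE MEMBER-FREE `K_A`** above the two thresholds `hTq`, `hTqV` on `m = M_h ≥ 1`: the four
summands `N·(S·Xₖ(m))·c·(1 − qₖ(m))⁻¹` of the constant of `B9Thm310DeltaAIsUnitOfExpansion.eBlock_kernelFamilyBInv_GAY_of_localInverseCubes''` (letters: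
`S = M₂Σ‖b_j‖`, `N = 3·5^{d+1}`, `c = c₁(d′, δ₀, α)`, `E = e^{αδ₀(2ℓ+6)}`, `θ = θ₃₈₉ᴮ`, `L = ℓ + 1`, `Θ′ = K_R·m⁻¹`, `θ_V′ = K_V·m⁻¹`, the partition constants
`C₁ C₂ C_X s_T`, the exponentials `e e₂ e_α e_{α,2} e_L`, the plaquette window `h`) have `Xₖ(m) ≤ Xₖ(1)` and `qₖ(m) ≤ ½`, hence the constant is
`≤ K_A := S·Σₖ 2·N·(S·Xₖ(1))·c`. [cite: Balaban1985BackgroundPropagators, (3.106) p.414 + Thm 3.10 p.416 («For M sufficiently large»), bookkeeping] -/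
theorem member_constant_le_deltaA {S N c E θ L m KR KV B₀ b₁ C₁ C₂ CX sT D e e₂ eα eα₂ eL h : ℝ} {k : ℕ}
    (hS : 0 ≤ S) (hN : 0 ≤ N) (hc : 0 ≤ c) (hE : 0 ≤ E) (hL1 : 1 ≤ L) (hm1 : 1 ≤ m)
    (hB₀ : 0 ≤ B₀) (hC₁ : 0 ≤ C₁) (hC₂ : 0 ≤ C₂) (hCX : 0 ≤ CX) (hD : 0 ≤ D) (he : 0 ≤ e) (he₂ : 0 ≤ e₂) (heα : 0 ≤ eα) (heα₂ : 0 ≤ eα₂)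
    (hTq : 2 * (((N * (E * c)) * (S * θ * L⁻¹) + KR) * c) ≤ m)
    (hTqV : 2 * (((N * (E * c)) * (S * ((B₀ * (D * (eα₂ * c) * e₂ * ((2 * D + 4) * (5 / 8 * C₁) + (5 / 8) ^ 2 * (C₂ + 2 * CX)
          + 8 * h * L ^ 5 * (5 / 8 * C₁) + 64 * h * L ^ 7 * (5 / 8 * C₁)) + (E * c) * eL * (4 * b₁ * L ^ 6 * (L ^ k) ^ 5 * (sT / L * (L + 3))))) * L ^ 5))
          + KV) * c) ≤ m) :
    (S * ((N) * (S * B₀) * c * (1 - ((N * (E * c)) * (S * θ * (L * m)⁻¹) + KR * m⁻¹) * c)⁻¹ + ((N * (E * c)) * (S * (B₀ * (1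
          + 5 * C₁ * (L * e) / (8 * m))))) * c * (1 - ((N * (E * c)) * (S * θ * (L * m)⁻¹) + KR * m⁻¹) * c)⁻¹ + ((N * (E * c)) * (S * (B₀ * (1
          + eα * c * e * (5 / 8 * C₁ / m))))) * c * (1 - ((N * (E * c)) * (S * ((B₀ * (D * (eα₂ * c) * e₂ * ((2 * D + 4) * (5 / 8 * C₁ / m)
          + (5 / 8) ^ 2 * (C₂ + 2 * CX) / m ^ 2 + 8 * h * L ^ 5 * (5 / 8 * C₁ / m) + 64 * h * L ^ 7 * (5 / 8 * C₁ / m)) + (E * c) * eL * (4 * b₁ * L ^ 6 * (L ^ k) ^ 5 * (sT / (L * m) * (L + 3))))) * L ^ 5))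
          + KV * m⁻¹) * c)⁻¹ + ((N * (E * c)) * (S * (B₀ * (1 + D * (5 / 8 * C₁ / m * (e + 1) + 25 / 64 * C₂ / m ^ 2))))) * c * (1 - ((N * (E * c)) * (S * θ * (L * m)⁻¹)
          + KR * m⁻¹) * c)⁻¹))
      ≤ S * (2 * ((N) * (S * B₀) * c) + 2 * (((N * (E * c)) * (S * (B₀ * (1 + 5 * C₁ * (L * e) / 8)))) * c) + 2 * (((N * (E * c)) * (S * (B₀ * (1
            + eα * c * e * (5 / 8 * C₁))))) * c) + 2 * (((N * (E * c)) * (S * (B₀ * (1 + D * (5 / 8 * C₁ * (e + 1) + 25 / 64 * C₂))))) * c)) := by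
  have hm0 : 0 < m := one_pos.trans_le hm1
  have hL0 : 0 < L := one_pos.trans_le hL1
  have hm2 : m ≤ m ^ 2 := by nlinarith only [hm1]
  have hEc : 0 ≤ E * c := mul_nonneg hE hc
  have hN' : 0 ≤ N * (E * c) := mul_nonneg hN hEc
  -- the first smallness quantity `q ≦ ½`
  have hq : ((N * (E * c)) * (S * θ * (L * m)⁻¹) + KR * m⁻¹) * c ≤ 2⁻¹ := by
    rw [show ((N * (E * c)) * (S * θ * (L * m)⁻¹) + KR * m⁻¹) * c = ((N * (E * c)) * (S * θ * L⁻¹) + KR) * c * m⁻¹ by rw [mul_inv]; ring]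
    exact inv_small hm0 hTq
  -- the second smallness quantity `q_V ≦ ½`: every summand of the bracket carries `m⁻¹` (or `m⁻²`)
  have hC1m : 5 / 8 * C₁ / m = 5 / 8 * C₁ * m⁻¹ := div_eq_mul_inv _ _
  have hC2m : (5 / 8) ^ 2 * (C₂ + 2 * CX) / m ^ 2 ≤ (5 / 8) ^ 2 * (C₂ + 2 * CX) * m⁻¹ := by
    rw [div_eq_mul_inv]
    exact mul_le_mul_of_nonneg_left (inv_anti₀ hm0 hm2) (by positivity)
  have h1 : (2 * D + 4) * (5 / 8 * C₁ / m) + (5 / 8) ^ 2 * (C₂ + 2 * CX) / m ^ 2 + 8 * h * L ^ 5 * (5 / 8 * C₁ / m) + 64 * h * L ^ 7 * (5 / 8 * C₁ / m)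
      ≤ ((2 * D + 4) * (5 / 8 * C₁) + (5 / 8) ^ 2 * (C₂ + 2 * CX) + 8 * h * L ^ 5 * (5 / 8 * C₁) + 64 * h * L ^ 7 * (5 / 8 * C₁)) * m⁻¹ := by
    rw [hC1m]
    have : ((2 * D + 4) * (5 / 8 * C₁) + (5 / 8) ^ 2 * (C₂ + 2 * CX) + 8 * h * L ^ 5 * (5 / 8 * C₁) + 64 * h * L ^ 7 * (5 / 8 * C₁)) * m⁻¹
        = (2 * D + 4) * (5 / 8 * C₁ * m⁻¹) + (5 / 8) ^ 2 * (C₂ + 2 * CX) * m⁻¹ + 8 * h * L ^ 5 * (5 / 8 * C₁ * m⁻¹)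
          + 64 * h * L ^ 7 * (5 / 8 * C₁ * m⁻¹) := by ring
    rw [this]
    linarith only [hC2m]
  have h3 : 4 * b₁ * L ^ 6 * (L ^ k) ^ 5 * (sT / (L * m) * (L + 3))
      = (4 * b₁ * L ^ 6 * (L ^ k) ^ 5 * (sT / L * (L + 3))) * m⁻¹ := by
    rw [div_mul_eq_div_div, div_eq_mul_inv (sT / L)]; ring
  have hin : D * (eα₂ * c) * e₂ * ((2 * D + 4) * (5 / 8 * C₁ / m) + (5 / 8) ^ 2 * (C₂ + 2 * CX) / m ^ 2 + 8 * h * L ^ 5 * (5 / 8 * C₁ / m)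
        + 64 * h * L ^ 7 * (5 / 8 * C₁ / m)) + (E * c) * eL * (4 * b₁ * L ^ 6 * (L ^ k) ^ 5 * (sT / (L * m) * (L + 3)))
      ≤ (D * (eα₂ * c) * e₂ * ((2 * D + 4) * (5 / 8 * C₁) + (5 / 8) ^ 2 * (C₂ + 2 * CX) + 8 * h * L ^ 5 * (5 / 8 * C₁) + 64 * h * L ^ 7 * (5 / 8 * C₁))
            + (E * c) * eL * (4 * b₁ * L ^ 6 * (L ^ k) ^ 5 * (sT / L * (L + 3)))) * m⁻¹ := by
    have h0 : 0 ≤ D * (eα₂ * c) * e₂ := by positivity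
    have h2 := mul_le_mul_of_nonneg_left h1 h0
    rw [h3]
    calc D * (eα₂ * c) * e₂ * ((2 * D + 4) * (5 / 8 * C₁ / m) + (5 / 8) ^ 2 * (C₂ + 2 * CX) / m ^ 2 + 8 * h * L ^ 5 * (5 / 8 * C₁ / m)
          + 64 * h * L ^ 7 * (5 / 8 * C₁ / m)) + (E * c) * eL * ((4 * b₁ * L ^ 6 * (L ^ k) ^ 5 * (sT / L * (L + 3))) * m⁻¹)
        ≤ D * (eα₂ * c) * e₂ * (((2 * D + 4) * (5 / 8 * C₁) + (5 / 8) ^ 2 * (C₂ + 2 * CX) + 8 * h * L ^ 5 * (5 / 8 * C₁)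
              + 64 * h * L ^ 7 * (5 / 8 * C₁)) * m⁻¹) + (E * c) * eL * ((4 * b₁ * L ^ 6 * (L ^ k) ^ 5 * (sT / L * (L + 3))) * m⁻¹) := add_le_add h2 le_rfl
      _ = _ := by ring
  have hbr : (B₀ * (D * (eα₂ * c) * e₂ * ((2 * D + 4) * (5 / 8 * C₁ / m) + (5 / 8) ^ 2 * (C₂ + 2 * CX) / m ^ 2 + 8 * h * L ^ 5 * (5 / 8 * C₁ / m)
        + 64 * h * L ^ 7 * (5 / 8 * C₁ / m)) + (E * c) * eL * (4 * b₁ * L ^ 6 * (L ^ k) ^ 5 * (sT / (L * m) * (L + 3))))) * L ^ 5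
      ≤ ((B₀ * (D * (eα₂ * c) * e₂ * ((2 * D + 4) * (5 / 8 * C₁) + (5 / 8) ^ 2 * (C₂ + 2 * CX) + 8 * h * L ^ 5 * (5 / 8 * C₁)
            + 64 * h * L ^ 7 * (5 / 8 * C₁)) + (E * c) * eL * (4 * b₁ * L ^ 6 * (L ^ k) ^ 5 * (sT / L * (L + 3))))) * L ^ 5) * m⁻¹ := by
    have hL5 : 0 ≤ L ^ 5 := pow_nonneg hL0.le 5
    calc (B₀ * (D * (eα₂ * c) * e₂ * ((2 * D + 4) * (5 / 8 * C₁ / m) + (5 / 8) ^ 2 * (C₂ + 2 * CX) / m ^ 2 + 8 * h * L ^ 5 * (5 / 8 * C₁ / m)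
          + 64 * h * L ^ 7 * (5 / 8 * C₁ / m)) + (E * c) * eL * (4 * b₁ * L ^ 6 * (L ^ k) ^ 5 * (sT / (L * m) * (L + 3))))) * L ^ 5
        ≤ (B₀ * ((D * (eα₂ * c) * e₂ * ((2 * D + 4) * (5 / 8 * C₁) + (5 / 8) ^ 2 * (C₂ + 2 * CX) + 8 * h * L ^ 5 * (5 / 8 * C₁)
              + 64 * h * L ^ 7 * (5 / 8 * C₁)) + (E * c) * eL * (4 * b₁ * L ^ 6 * (L ^ k) ^ 5 * (sT / L * (L + 3)))) * m⁻¹)) * L ^ 5 :=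
          mul_le_mul_of_nonneg_right (mul_le_mul_of_nonneg_left hin hB₀) hL5
      _ = _ := by ring
  have hqV : ((N * (E * c)) * (S * ((B₀ * (D * (eα₂ * c) * e₂ * ((2 * D + 4) * (5 / 8 * C₁ / m) + (5 / 8) ^ 2 * (C₂ + 2 * CX) / m ^ 2
        + 8 * h * L ^ 5 * (5 / 8 * C₁ / m) + 64 * h * L ^ 7 * (5 / 8 * C₁ / m)) + (E * c) * eL * (4 * b₁ * L ^ 6 * (L ^ k) ^ 5 * (sT / (L * m) * (L + 3))))) * L ^ 5))
        + KV * m⁻¹) * c ≤ 2⁻¹ := by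
    have h4 := mul_le_mul_of_nonneg_right (add_le_add (mul_le_mul_of_nonneg_left (mul_le_mul_of_nonneg_left hbr hS) hN') (le_refl (KV * m⁻¹))) hc
    refine h4.trans (le_trans (le_of_eq ?_) (inv_small hm0 hTqV))
    ring
  -- the `m`-dependent numerators at most their `m = 1` values
  have hx1 : 0 ≤ (N) * (S * B₀) * c := by positivity
  have hx2 : 0 ≤ ((N * (E * c)) * (S * (B₀ * (1 + 5 * C₁ * (L * e) / (8 * m))))) * c := by positivity
  have hx2' : ((N * (E * c)) * (S * (B₀ * (1 + 5 * C₁ * (L * e) / (8 * m))))) * c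
      ≤ ((N * (E * c)) * (S * (B₀ * (1 + 5 * C₁ * (L * e) / 8)))) * c := by
    have h8 : 5 * C₁ * (L * e) / (8 * m) ≤ 5 * C₁ * (L * e) / 8 :=
      div_le_div_of_nonneg_left (by positivity) (by norm_num) (by linarith only [hm1])
    gcongr
  have hx3 : 0 ≤ ((N * (E * c)) * (S * (B₀ * (1 + eα * c * e * (5 / 8 * C₁ / m))))) * c := by positivity
  have hx3' : ((N * (E * c)) * (S * (B₀ * (1 + eα * c * e * (5 / 8 * C₁ / m))))) * c
      ≤ ((N * (E * c)) * (S * (B₀ * (1 + eα * c * e * (5 / 8 * C₁))))) * c := by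
    have h8 : 5 / 8 * C₁ / m ≤ 5 / 8 * C₁ := div_le_self (by positivity) hm1
    gcongr
  have hx4 : 0 ≤ ((N * (E * c)) * (S * (B₀ * (1 + D * (5 / 8 * C₁ / m * (e + 1) + 25 / 64 * C₂ / m ^ 2))))) * c := by positivity
  have hx4' : ((N * (E * c)) * (S * (B₀ * (1 + D * (5 / 8 * C₁ / m * (e + 1) + 25 / 64 * C₂ / m ^ 2))))) * c
      ≤ ((N * (E * c)) * (S * (B₀ * (1 + D * (5 / 8 * C₁ * (e + 1) + 25 / 64 * C₂))))) * c := by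
    have h8 : 5 / 8 * C₁ / m ≤ 5 / 8 * C₁ := div_le_self (by positivity) hm1
    have h9 : 25 / 64 * C₂ / m ^ 2 ≤ 25 / 64 * C₂ := div_le_self (by positivity) (one_le_pow₀ hm1)
    gcongr
  exact mul_le_mul_of_nonneg_left (add_le_add (add_le_add (add_le_add (frac_le_two hx1 le_rfl hq) (frac_le_two hx2 hx2' hq))
    (frac_le_two hx3 hx3' hqV)) (frac_le_two hx4 hx4' hq)) hS
/-! ## §1 ★★★ Theorem 3.10 ⇒ Theorem 3.3 at the member from cube data: the bond-sector member assembler -/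

set_option maxHeartbeats 4000000 in
/-- ★★★ **THE BOND-SECTOR MEMBER ASSEMBLER — [B9] THM 3.3 FOR `G = Δ_a⁻¹` VIA THM 3.10 AT THE MEMBER FROM CUBE DATA** (p. 414 (3.105)–(3.106) «Δ_aG₀ = I − R»,
«R satisfies the bound (3.85) with O(M⁻¹) instead of O(α₁). For M sufficiently large this implies G = G₀(I − R)⁻¹», p. 416 (after (3.108)) «This implies Theorem 3.3.»;
Cor. 3.6 p. 408; (3.69) p. 404).  At the unitary matrix fibre `M_N(ℂ)` (L²-operator norm), for every `d` and `0 < b₀ ≤ b₁`, a real basis `b` with coordinate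
bound `M₂`, and `ℓ ≥ 1`: THERE ARE member-free `δ_A > 0`, `K_A ≥ 0`, thresholds `M₀ T₀ N₀`, a (3.37) size `a₁ > 0` and a plaquette window `δh₀ > 0` such that
for every member `i` above the thresholds with `c_f = L^k`, every section `ιB` of the block map, every `U(N)`-valued `U` whose plaquette variables satisfy
`‖U(∂p) − 1‖ ≤ δh·L^{−2·lev p}` with `0 ≤ δh ≤ δh₀`, every family of bi-contractive gauges `u_□` and data `(A_□, Q_□, C_□, ξ_□, Λ_□)_□` obeying the twelve
clauses of Cor. 3.6 (the last at `a₁` and at `¼`), and every background family `cfg` through `U`: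
(1ₛ) `IsUnit (deltaAY i parSymY parBY (GpY i parSymY) U)` and (Eₛ) `EBlock (kernelFamilyBInv i B cfg (GAY i parSymY parBY (GpY i parSymY)) par) K_A δ_A U₁`.
PROOF = module M5.7's endpoint `eBlock_kernelFamilyBInv_GAY_of_localInverseCubes''` ∕ `isUnit_deltaAY_of_localInverse` at the located letters of record at
`Aʰ_□ = ½(A_□ + A_□⋆)`, fed by ASM1-R `rest_at_member` and ASM1-V `restT_at_member` at the common rate `δ₀ = min(δ_R, δ_V)`, `α = ¼` (`δ_A = δ₀∕2`), [4]
Lemma 2.1 ∕ (2.63) from `geo_inputs3_geo9K`, `η = |c_f|⁻¹` from `c_f = L^k`, the plaquette datum at the window `δh₀ = 1`, both located smallness quantities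
`≤ ½` and the constant `≤ K_A` by §0 above the threshold on `L·M_h`.  HONEST SCOPE as in the module docstring: assembly only; the (3.35) data stay the
consumer's; nothing about positivity; YM mass gap NOT proved.
[cite: Balaban1985BackgroundPropagators, Thm 3.3 p.399 + (3.42) p.397 via Thm 3.10 pp.414–416, (3.105)–(3.106) p.414, Cor. 3.6 p.408, (3.35)–(3.37) p.396, (3.69) p.404; Balaban1984PropagatorsII, Lemma 2.1 (2.60)–(2.63) p.234, Prop. 2.2 (2.65)–(2.67) p.234] -/
theorem deltaA_at_member_of_cubeData {N : ℕ} [NeZero N] [DecidableEq ι]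
    [∀ i' : KIdx d ℓ hd hL b₀ b₁, Fintype (geo9K i').Site] [∀ i' : KIdx d ℓ hd hL b₀ b₁, DecidableEq (geo9K i').Site]
    (b : Module.Basis ι ℝ (Matrix (Fin N) (Fin N) ℂ)) (hℓ : 1 ≤ ℓ) (hb₀ : 0 < b₀) (hb₁ : b₀ ≤ b₁)
    {M₂ : ℝ} (hM₂ : 0 ≤ M₂) (hrepr : ∀ (v : (Matrix (Fin N) (Fin N) ℂ)) (j : ι), |b.repr v j| ≤ M₂ * ‖v‖) :
    ∃ δA KA M₀ T₀ : ℝ, ∃ N₀ : ℕ, 0 < δA ∧ 0 ≤ KA ∧ ∃ a₁ : ℝ, 0 < a₁ ∧ ∃ δh₀ : ℝ, 0 < δh₀ ∧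
      ∀ (i : KIdx d ℓ hd hL b₀ b₁),
        M₀ ≤ ((ℓ : ℝ) + 1) * (toKT i).Mh → N₀ + 1 ≤ (toKT i).R * ((ℓ + 1) * (toKT i).Mh) → T₀ ≤ RM1 i →
        i.cf = (((ℓ + 1 : ℕ) : ℝ)) ^ i.k →
      ∀ (ιB : BlkY i → IBondY i), (∀ s, β i.hN i.D i.hk (ιB s) = s) →
      ∀ (U : CfgY (Matrix (Fin N) (Fin N) ℂ) i), (∀ μ x, U μ x ∈ unitaryUnits (Matrix (Fin N) (Fin N) ℂ)) →
      ∀ (δh : ℝ), 0 ≤ δh → δh ≤ δh₀ →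
        (∀ p : PlaqY i, ‖((holY i U p : (Matrix (Fin N) (Fin N) ℂ)ˣ) : Matrix (Fin N) (Fin N) ℂ) - 1‖ ≤
          δh * ((((ℓ : ℝ) + 1) ^ levY i (chartY i p.src))⁻¹) ^ 2) →
      ∀ (g : ↥(cubes (toKT i).D.toDomains) → GaugeY (Matrix (Fin N) (Fin N) ℂ) i),
        (∀ c x, ‖(g c x : Matrix (Fin N) (Fin N) ℂ)‖ ≤ 1 ∧ ‖(((g c x)⁻¹ : (Matrix (Fin N) (Fin N) ℂ)ˣ) : Matrix (Fin N) (Fin N) ℂ)‖ ≤ 1) →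
      ∀ (A : ↥(cubes (toKT i).D.toDomains) → AfldY (Matrix (Fin N) (Fin N) ℂ) i)
        (Q : ↥(cubes (toKT i).D.toDomains) → Set (Site (PV d ℓ i.m i.K hd hL) 0)) (C ξ Λ : ↥(cubes (toKT i).D.toDomains) → ℝ),
        (∀ c, 0 ≤ C c) → (∀ c, 0 < ξ c) → (∀ c, 1 ≤ Λ c) → (∀ c, ξ c ≤ 5 * (SC i c : ℝ) * (kGeo i).eta) →
        (∀ c, LatticeNorms.scaleLen ((ℓ : ℝ) + 1) (kGeo i).eta (c.1.1 + 1) ≤ Λ c * ξ c) →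
        (∀ c, ∀ x : Site (PV d ℓ i.m i.K hd hL) 0, NearC i c (35 * SC i c / 8 + 1) (boxEquiv i.hN x).1 → x ∈ Q c) →
        (∀ c, ∀ (κ : Fin (d + 1)) (x : Site (PV d ℓ i.m i.K hd hL) 0), x ∈ Q c → x.shift κ ∈ Q c →
          gaugeY i (g c) U κ x = fluct (kGeo i).eta (A c) κ x) →
        (∀ c, ∀ κ, ∀ x ∈ Q c, ‖A c κ x‖ ≤ C c * (ξ c)⁻¹) →
        (∀ c, ∀ μ ν, ∀ x ∈ Q c,
          ‖(((kGeo i).eta : ℂ)⁻¹) • covD (shiftsV1 (PV d ℓ i.m i.K hd hL)) (fun _ _ => (1 : (Matrix (Fin N) (Fin N) ℂ)ˣ)) μ (A c ν) x‖ ≤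
            C c * (ξ c ^ 2)⁻¹) →
        (∀ c, max (C c) (C c * (1 + D1 thetaProf)) * Λ c ^ 2 ≤ a₁) → (∀ c, max (C c) (C c * (1 + D1 thetaProf)) * Λ c ^ 2 ≤ 1 / 4) →
      ∀ {B : B9.Backgrounds} (cfg : B.Cfg → CfgY (Matrix (Fin N) (Fin N) ℂ) i) (par : BondParY (Matrix (Fin N) (Fin N) ℂ) i) (U₁ : B.Cfg),
        cfg U₁ = U →
        IsUnit (deltaAY i (parSymY i) (parBY i) (GpY i (parSymY i)) U) ∧
        EBlock (kernelFamilyBInv i B cfg (GAY i (parSymY i) (parBY i) (GpY i (parSymY i))) par) KA δA U₁ := by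
  classical
  letI : CStarAlgebra (Matrix (Fin N) (Fin N) ℂ) := {}
  have hL1 : (1 : ℝ) ≤ (ℓ : ℝ) + 1 := by linarith [(Nat.cast_nonneg ℓ : (0 : ℝ) ≤ ℓ)]
  have hL0 : (0 : ℝ) < (ℓ : ℝ) + 1 := by positivity
  have hb₁' : (0 : ℝ) ≤ b₁ := hb₀.le.trans hb₁
  -- ═══ the two halves of the (3.105) remainder (ASM1-R, ASM1-V), member-independent packages ═══
  obtain ⟨δR, KR, BR, M₀R, T₀R, N₀R, hδR, hKR, hBR, a₁R, ha₁R, HR⟩ :=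
    rest_at_member (fun _ : KIdx d ℓ hd hL b₀ b₁ => (0 : ℝ)) (fun _ => True) b hℓ hb₀ hb₁ hM₂ hrepr
  obtain ⟨δV, KV, M₀V, T₀V, N₀V, hδV, hKV, a₁V, ha₁V, HV⟩ :=
    restT_at_member (fun _ : KIdx d ℓ hd hL b₀ b₁ => (0 : ℝ)) (fun _ => True) b hℓ hb₀ hb₁ hM₂ hrepr
  -- ═══ the common rate `δ₀ = min(δ_R, δ_V)` and `α = ¼` ═══
  obtain ⟨δ₀, hδ₀def⟩ : ∃ x : ℝ, x = min δR δV := ⟨_, rfl⟩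
  have hδ₀ : 0 < δ₀ := by rw [hδ₀def]; exact lt_min hδR hδV
  have hδ₀R : δ₀ ≤ δR := by rw [hδ₀def]; exact min_le_left _ _
  have hδ₀V : δ₀ ≤ δV := by rw [hδ₀def]; exact min_le_right _ _
  obtain ⟨α, hαdef⟩ : ∃ x : ℝ, x = 1 / 4 := ⟨_, rfl⟩
  have hα0 : 0 < α := by rw [hαdef]; norm_num
  have hα1 : α ≤ 1 := by rw [hαdef]; norm_num
  have hαδ : 0 < α * δ₀ := mul_pos hα0 hδ₀
  have hαδ2 : 0 ≤ (1 - 2 * α) * δ₀ := by rw [hαdef]; linarith only [hδ₀]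
  have hαδ1 : 0 ≤ (1 - α) * δ₀ := by rw [hαdef]; linarith only [hδ₀]
  have hδA : 0 < (1 - 2 * α) * δ₀ := by rw [hαdef]; linarith only [hδ₀]
  -- ═══ [4] Lemma 2.1 and (2.63) at `(δ₀, α)` above one threshold (all three pairs equal), at an exponent `d'` ═══
  obtain ⟨MLg, hgeo⟩ := geo_inputs3_geo9K (fun _ : KIdx d ℓ hd hL b₀ b₁ => (0 : ℝ)) (fun _ => True) hαδ hαδ hαδ hδ₀.le hα1
  obtain ⟨d', hgeo'⟩ : ∃ d' : ℕ, ∀ i : KIdx d ℓ hd hL b₀ b₁, MLg ≤ (geo9K i).M →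
      Ineq261 d' (toB6 (geo9K i) (0 : ℝ) True) δ₀ α ∧ Ineq263 d' (toB6 (geo9K i) (0 : ℝ) True) δ₀ α :=
    ⟨_, fun i hM => by obtain ⟨-, -, -, -, -, -, h7, h8⟩ := hgeo i hM; exact ⟨h7, h8⟩⟩
  -- ═══ the member-free letters ═══
  obtain ⟨S, hS⟩ : ∃ x : ℝ, x = M₂ * (∑ j, ‖b j‖) := ⟨_, rfl⟩
  obtain ⟨c, hc⟩ : ∃ x : ℝ, x = B6.c1 d' δ₀ α := ⟨_, rfl⟩
  obtain ⟨E, hE⟩ : ∃ x : ℝ, x = Real.exp (α * δ₀ * (2 * (ℓ : ℝ) + 6)) := ⟨_, rfl⟩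
  obtain ⟨θ, hθ⟩ : ∃ x : ℝ, x = theta389B d ℓ BR b₁ δ₀ 1 (2 * 1) (1 * (((ℓ : ℝ) + 1) ^ 2 + 1)) 1 0 := ⟨_, rfl⟩
  have hS0 : 0 ≤ S := by rw [hS]; exact mul_nonneg hM₂ (Finset.sum_nonneg fun _ _ => norm_nonneg _)
  have hc0 : 0 ≤ c := by rw [hc]; exact c1_nonneg _ _ _
  have hE0 : 0 ≤ E := by rw [hE]; exact Real.exp_nonneg _
  have hθ0 : 0 ≤ θ := by rw [hθ]; exact theta389B_nonneg d ℓ hBR hb₁' zero_le_one (by norm_num) (by positivity) zero_le_one δ₀ 0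
  have hN0 : (0 : ℝ) ≤ 3 * 5 ^ (d + 1) := by positivity
  have hC₁ := C1F_nonneg d ℓ
  have hC₂ := C2F_nonneg d ℓ
  have hCX : 0 ≤ C2X d ℓ := (C2X_bounds d ℓ).2.2
  have hsT := sLipT_nonneg d ℓ
  have hD0 : (0 : ℝ) ≤ (d : ℝ) + 1 := by positivity
  have he : 0 ≤ Real.exp δ₀ := Real.exp_nonneg _
  have he₂ : 0 ≤ Real.exp (δ₀ * 2) := Real.exp_nonneg _
  have heα : 0 ≤ Real.exp (α * δ₀) := Real.exp_nonneg _
  have heα₂ : 0 ≤ Real.exp (α * δ₀ * 2) := Real.exp_nonneg _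
  have heL : 0 ≤ Real.exp (δ₀ * (2 * (ℓ : ℝ) + 6)) := Real.exp_nonneg _
  -- the two thresholds on `M_h` and the member-free constant
  obtain ⟨Tq, hTqdef⟩ : ∃ x : ℝ, x = 2 * (((3 * 5 ^ (d + 1) * (E * c)) * (S * θ * ((ℓ : ℝ) + 1)⁻¹) + KR) * c) := ⟨_, rfl⟩
  obtain ⟨TqV, hTqVdef⟩ : ∃ x : ℝ, x = 2 * (((3 * 5 ^ (d + 1) * (E * c)) * (S * ((BR * (((d : ℝ) + 1) * (Real.exp (α * δ₀ * 2) * c) * Real.exp (δ₀ * 2) * ((2 * ((d : ℝ) + 1) + 4) * (5 / 8 * C1F d ℓ)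
        + (5 / 8) ^ 2 * (C2F d ℓ + 2 * C2X d ℓ) + 8 * 1 * ((ℓ : ℝ) + 1) ^ 5 * (5 / 8 * C1F d ℓ) + 64 * 1 * ((ℓ : ℝ) + 1) ^ 7 * (5 / 8 * C1F d ℓ))
        + (E * c) * Real.exp (δ₀ * (2 * (ℓ : ℝ) + 6)) * (4 * b₁ * ((ℓ : ℝ) + 1) ^ 6 * (((ℓ : ℝ) + 1) ^ (d + 1)) ^ 5 * (sLipT d ℓ / ((ℓ : ℝ) + 1) * (((ℓ : ℝ) + 1) + 3))))) * ((ℓ : ℝ) + 1) ^ 5))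
        + KV) * c) := ⟨_, rfl⟩
  obtain ⟨KA, hKAdef⟩ : ∃ x : ℝ, x = S * (2 * ((3 * 5 ^ (d + 1)) * (S * BR) * c) + 2 * (((3 * 5 ^ (d + 1) * (E * c)) * (S * (BR * (1
        + 5 * C1F d ℓ * (((ℓ : ℝ) + 1) * Real.exp δ₀) / 8)))) * c) + 2 * (((3 * 5 ^ (d + 1) * (E * c)) * (S * (BR * (1 + Real.exp (α * δ₀) * c * Real.exp δ₀ * (5 / 8 * C1F d ℓ))))) * c)
        + 2 * (((3 * 5 ^ (d + 1) * (E * c)) * (S * (BR * (1 + ((d : ℝ) + 1) * (5 / 8 * C1F d ℓ * (Real.exp δ₀ + 1) + 25 / 64 * C2F d ℓ))))) * c)) := ⟨_, rfl⟩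
  have hKA0 : 0 ≤ KA := by rw [hKAdef]; positivity
  refine ⟨(1 - 2 * α) * δ₀, KA, max (max M₀R M₀V) (max MLg (((ℓ : ℝ) + 1) * max Tq TqV)), max T₀R T₀V, max N₀R N₀V, hδA, hKA0,
    min a₁R a₁V, lt_min ha₁R ha₁V, 1, one_pos, ?_⟩
  intro i hM hN hT hcf ιB hι U hUu δh hδh0 hδh1 hW g hg A Q C ξ Λ hC0 hξ hΛ hξS hΛξ hQ hgA hAb hdA hs₁ hs₄ B cfg par U₁ hcfg
  -- ─── thresholds ───
  have hMR : M₀R ≤ ((ℓ : ℝ) + 1) * (toKT i).Mh := ((le_max_left _ _).trans (le_max_left _ _)).trans hM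
  have hMV : M₀V ≤ ((ℓ : ℝ) + 1) * (toKT i).Mh := ((le_max_right _ _).trans (le_max_left _ _)).trans hM
  have hMg : MLg ≤ (geo9K i).M := by
    rw [geo9K_M_eq' i]; exact ((le_max_left _ _).trans (le_max_right _ _)).trans hM
  have hMhEq : ((toKT i).Mh : ℝ) = (i.Mh : ℝ) := rfl
  have hm8 : (8 : ℝ) ≤ (i.Mh : ℝ) := by exact_mod_cast i.hM8
  have hm1 : (1 : ℝ) ≤ (i.Mh : ℝ) := by linarith only [hm8]
  have hm0 : (0 : ℝ) < (i.Mh : ℝ) := one_pos.trans_le hm1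
  have hMq : max Tq TqV ≤ (i.Mh : ℝ) := by
    have h := ((le_max_right _ _).trans (le_max_right _ _)).trans hM
    rw [hMhEq] at h
    exact le_of_mul_le_mul_left h hL0
  have hTq : Tq ≤ (i.Mh : ℝ) := (le_max_left _ _).trans hMq
  have hTqV : TqV ≤ (i.Mh : ℝ) := (le_max_right _ _).trans hMq
  have hTR : T₀R ≤ RM1 i := (le_max_left _ _).trans hT
  have hTV : T₀V ≤ RM1 i := (le_max_right _ _).trans hT
  have hNR : N₀R + 1 ≤ (toKT i).R * ((ℓ + 1) * (toKT i).Mh) := le_trans (Nat.succ_le_succ (le_max_left _ _)) hN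
  have hNV : N₀V + 1 ≤ (toKT i).R * ((ℓ + 1) * (toKT i).Mh) := le_trans (Nat.succ_le_succ (le_max_right _ _)) hN
  have hsR : ∀ c', max (C c') (C c' * (1 + D1 thetaProf)) * Λ c' ^ 2 ≤ a₁R := fun c' => (hs₁ c').trans (min_le_left _ _)
  have hsV : ∀ c', max (C c') (C c' * (1 + D1 thetaProf)) * Λ c' ^ 2 ≤ a₁V := fun c' => (hs₁ c').trans (min_le_right _ _)
  -- ─── the two halves at this member ───
  obtain ⟨hP1, hdef, hdefT, hEO, hUb, hTb, -, hrest⟩ :=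
    HR i hMR hNR hTR hcf ιB hι U hUu g hg A Q C ξ Λ hC0 hξ hΛ hξS hΛξ hQ hgA hAb hdA hsR hs₄ cfg par U₁ hcfg
  have hV' := HV i hMV hNV hTV hcf ιB hι U hUu g hg A Q C ξ Λ hC0 hξ hΛ hξS hΛξ hQ hgA hAb hdA hsV hs₄ cfg par U₁ hcfg
  subst hcfg
  -- ─── [4] (2.61) ∕ (2.63), `η = |c_f|⁻¹` ───
  obtain ⟨h261, h263⟩ := hgeo' i hMg
  have hη : etaS i = |i.cf|⁻¹ := by have h' := etaS_eq_kGeo_eta_of_cf i hcf; exact h'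
  -- ─── the common rate: blocks, `hrest`, `hV′`, the plaquette datum at the window ───
  have hdnn : ∀ a a' : (geo9K i).Site, 0 ≤ (geo9K i).dist a a' := B9GeoLemma21KLevelV1.geo9K_dist_nonneg' i
  have hE' : ∀ c' : ↥(cubes i.D.toDomains), EBlock (kernelFamilyBInv i B cfg (fun _ => locLetterBY i c' (parSymY i) (parBY i) (g c') (chiY i c')
      (locCfgY i c' (kGeo i).eta (fun κ x => (2 : ℂ)⁻¹ • (A c' κ x + star (A c' κ x))))) par) BR δ₀ U₁ :=
    fun c' => eBlock_rate_mono i _ le_rfl hδ₀R hBR (hEO c')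
  have hrest' := hasMajorant_mono _ hrest (K' := fun a a' => KR * ((i.Mh : ℝ))⁻¹ * Real.exp (-(δ₀ * (geo9K i).dist a a'))) (fun a a' => by
    have h1 : Real.exp (-(δR * (geo9K i).dist a a')) ≤ Real.exp (-(δ₀ * (geo9K i).dist a a')) :=
      Real.exp_le_exp.mpr (by have h' := mul_le_mul_of_nonneg_right hδ₀R (hdnn a a'); linarith only [h'])
    rw [hMhEq]
    exact mul_le_mul_of_nonneg_left h1 (mul_nonneg hKR (inv_nonneg.2 hm0.le)))
  have hV'' := hasMajorant_mono _ hV' (K' := fun a a' => KV * ((i.Mh : ℝ))⁻¹ * (geo9K i).len a * ((geo9K i).len a')⁻¹ *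
      Real.exp (-(δ₀ * (geo9K i).dist a a'))) (fun a a' => by
    have h1 : Real.exp (-(δV * (geo9K i).dist a a')) ≤ Real.exp (-(δ₀ * (geo9K i).dist a a')) :=
      Real.exp_le_exp.mpr (by have h' := mul_le_mul_of_nonneg_right hδ₀V (hdnn a a'); linarith only [h'])
    rw [hMhEq]
    exact mul_le_mul_of_nonneg_left h1 (mul_nonneg (mul_nonneg (mul_nonneg hKV (inv_nonneg.2 hm0.le))
      (B6KLevelCensusIndexV1.len_pos i a).le) (inv_nonneg.2 (B6KLevelCensusIndexV1.len_pos i a').le)))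
  have hW' : ∀ p : PlaqY i, ‖((holY i (cfg U₁) p : (Matrix (Fin N) (Fin N) ℂ)ˣ) : Matrix (Fin N) (Fin N) ℂ) - 1‖ ≤
      1 * ((((ℓ : ℝ) + 1) ^ levY i (chartY i p.src))⁻¹) ^ 2 :=
    fun p => (hW p).trans (mul_le_mul_of_nonneg_right hδh1 (sq_nonneg _))
  -- ─── the two located smallness quantities above the threshold (value `≤ ½ < 1`) ───
  have hq : ((3 * 5 ^ (d + 1) * (E * c)) * (S * θ * (((ℓ : ℝ) + 1) * (i.Mh : ℝ))⁻¹) + KR * (i.Mh : ℝ)⁻¹) * c < 1 := by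
    have h1 : ((3 * 5 ^ (d + 1) * (E * c)) * (S * θ * (((ℓ : ℝ) + 1) * (i.Mh : ℝ))⁻¹) + KR * (i.Mh : ℝ)⁻¹) * c = ((3 * 5 ^ (d + 1) * (E * c)) * (S * θ * ((ℓ : ℝ) + 1)⁻¹)
          + KR) * c * ((i.Mh : ℝ))⁻¹ := by
      rw [mul_inv]; ring
    rw [h1]
    exact lt_of_le_of_lt (inv_small hm0 (by rw [← hTqdef]; exact hTq)) (by norm_num)
  have hqV : ((3 * 5 ^ (d + 1) * (E * c)) * (S * ((BR * (((d : ℝ) + 1) * (Real.exp (α * δ₀ * 2) * c) * Real.exp (δ₀ * 2) * ((2 * ((d : ℝ) + 1) + 4) * (5 / 8 * C1F d ℓ / (i.Mh : ℝ))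
        + (5 / 8) ^ 2 * (C2F d ℓ + 2 * C2X d ℓ) / (i.Mh : ℝ) ^ 2 + 8 * 1 * ((ℓ : ℝ) + 1) ^ 5 * (5 / 8 * C1F d ℓ / (i.Mh : ℝ))
        + 64 * 1 * ((ℓ : ℝ) + 1) ^ 7 * (5 / 8 * C1F d ℓ / (i.Mh : ℝ))) + (E * c) * Real.exp (δ₀ * (2 * (ℓ : ℝ) + 6)) * (4 * b₁ * ((ℓ : ℝ) + 1) ^ 6 * (((ℓ : ℝ) + 1) ^ (d + 1)) ^ 5 * (sLipT d ℓ / (((ℓ : ℝ) + 1) * (i.Mh : ℝ)) * (((ℓ : ℝ) + 1) + 3))))) * ((ℓ : ℝ) + 1) ^ 5))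
        + KV * (i.Mh : ℝ)⁻¹) * c < 1 := by
    -- every summand of the bracket carries `M_h⁻¹` (or `M_h⁻²`): the bracket is at most its `M_h = 1` value times `M_h⁻¹`
    have hm2 : (i.Mh : ℝ) ≤ (i.Mh : ℝ) ^ 2 := by nlinarith only [hm1]
    have hC1m : 5 / 8 * C1F d ℓ / (i.Mh : ℝ) = 5 / 8 * C1F d ℓ * ((i.Mh : ℝ))⁻¹ := div_eq_mul_inv _ _
    have hC2m : (5 / 8) ^ 2 * (C2F d ℓ + 2 * C2X d ℓ) / (i.Mh : ℝ) ^ 2 ≤ (5 / 8) ^ 2 * (C2F d ℓ + 2 * C2X d ℓ) * ((i.Mh : ℝ))⁻¹ := by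
      rw [div_eq_mul_inv]; exact mul_le_mul_of_nonneg_left (inv_anti₀ hm0 hm2) (by positivity)
    have h1 : (2 * ((d : ℝ) + 1) + 4) * (5 / 8 * C1F d ℓ / (i.Mh : ℝ)) + (5 / 8) ^ 2 * (C2F d ℓ + 2 * C2X d ℓ) / (i.Mh : ℝ) ^ 2
          + 8 * 1 * ((ℓ : ℝ) + 1) ^ 5 * (5 / 8 * C1F d ℓ / (i.Mh : ℝ)) + 64 * 1 * ((ℓ : ℝ) + 1) ^ 7 * (5 / 8 * C1F d ℓ / (i.Mh : ℝ))
        ≤ ((2 * ((d : ℝ) + 1) + 4) * (5 / 8 * C1F d ℓ) + (5 / 8) ^ 2 * (C2F d ℓ + 2 * C2X d ℓ) + 8 * 1 * ((ℓ : ℝ) + 1) ^ 5 * (5 / 8 * C1F d ℓ)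
              + 64 * 1 * ((ℓ : ℝ) + 1) ^ 7 * (5 / 8 * C1F d ℓ)) * ((i.Mh : ℝ))⁻¹ := by
      rw [hC1m]
      have : ((2 * ((d : ℝ) + 1) + 4) * (5 / 8 * C1F d ℓ) + (5 / 8) ^ 2 * (C2F d ℓ + 2 * C2X d ℓ) + 8 * 1 * ((ℓ : ℝ) + 1) ^ 5 * (5 / 8 * C1F d ℓ)
            + 64 * 1 * ((ℓ : ℝ) + 1) ^ 7 * (5 / 8 * C1F d ℓ)) * ((i.Mh : ℝ))⁻¹
          = (2 * ((d : ℝ) + 1) + 4) * (5 / 8 * C1F d ℓ * ((i.Mh : ℝ))⁻¹) + (5 / 8) ^ 2 * (C2F d ℓ + 2 * C2X d ℓ) * ((i.Mh : ℝ))⁻¹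
            + 8 * 1 * ((ℓ : ℝ) + 1) ^ 5 * (5 / 8 * C1F d ℓ * ((i.Mh : ℝ))⁻¹) + 64 * 1 * ((ℓ : ℝ) + 1) ^ 7 * (5 / 8 * C1F d ℓ * ((i.Mh : ℝ))⁻¹) := by ring
      rw [this]; linarith only [hC2m]
    have h3 : 4 * b₁ * ((ℓ : ℝ) + 1) ^ 6 * (((ℓ : ℝ) + 1) ^ (d + 1)) ^ 5 * (sLipT d ℓ / (((ℓ : ℝ) + 1) * (i.Mh : ℝ)) * (((ℓ : ℝ) + 1) + 3))
        = (4 * b₁ * ((ℓ : ℝ) + 1) ^ 6 * (((ℓ : ℝ) + 1) ^ (d + 1)) ^ 5 * (sLipT d ℓ / ((ℓ : ℝ) + 1) * (((ℓ : ℝ) + 1) + 3))) * ((i.Mh : ℝ))⁻¹ := by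
      rw [div_mul_eq_div_div, div_eq_mul_inv (sLipT d ℓ / ((ℓ : ℝ) + 1))]; ring
    have hin : ((d : ℝ) + 1) * (Real.exp (α * δ₀ * 2) * c) * Real.exp (δ₀ * 2) * ((2 * ((d : ℝ) + 1) + 4) * (5 / 8 * C1F d ℓ / (i.Mh : ℝ))
          + (5 / 8) ^ 2 * (C2F d ℓ + 2 * C2X d ℓ) / (i.Mh : ℝ) ^ 2 + 8 * 1 * ((ℓ : ℝ) + 1) ^ 5 * (5 / 8 * C1F d ℓ / (i.Mh : ℝ))
          + 64 * 1 * ((ℓ : ℝ) + 1) ^ 7 * (5 / 8 * C1F d ℓ / (i.Mh : ℝ))) + (E * c) * Real.exp (δ₀ * (2 * (ℓ : ℝ) + 6)) * (4 * b₁ * ((ℓ : ℝ) + 1) ^ 6 * (((ℓ : ℝ) + 1) ^ (d + 1)) ^ 5 * (sLipT d ℓ / (((ℓ : ℝ) + 1) * (i.Mh : ℝ)) * (((ℓ : ℝ) + 1) + 3)))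
        ≤ (((d : ℝ) + 1) * (Real.exp (α * δ₀ * 2) * c) * Real.exp (δ₀ * 2) * ((2 * ((d : ℝ) + 1) + 4) * (5 / 8 * C1F d ℓ)
              + (5 / 8) ^ 2 * (C2F d ℓ + 2 * C2X d ℓ) + 8 * 1 * ((ℓ : ℝ) + 1) ^ 5 * (5 / 8 * C1F d ℓ) + 64 * 1 * ((ℓ : ℝ) + 1) ^ 7 * (5 / 8 * C1F d ℓ))
          + (E * c) * Real.exp (δ₀ * (2 * (ℓ : ℝ) + 6)) * (4 * b₁ * ((ℓ : ℝ) + 1) ^ 6 * (((ℓ : ℝ) + 1) ^ (d + 1)) ^ 5 * (sLipT d ℓ / ((ℓ : ℝ) + 1) * (((ℓ : ℝ) + 1) + 3)))) * ((i.Mh : ℝ))⁻¹ := by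
      have h0 : 0 ≤ ((d : ℝ) + 1) * (Real.exp (α * δ₀ * 2) * c) * Real.exp (δ₀ * 2) := by positivity
      have h2 := mul_le_mul_of_nonneg_left h1 h0
      rw [h3]
      calc ((d : ℝ) + 1) * (Real.exp (α * δ₀ * 2) * c) * Real.exp (δ₀ * 2) * ((2 * ((d : ℝ) + 1) + 4) * (5 / 8 * C1F d ℓ / (i.Mh : ℝ))
            + (5 / 8) ^ 2 * (C2F d ℓ + 2 * C2X d ℓ) / (i.Mh : ℝ) ^ 2 + 8 * 1 * ((ℓ : ℝ) + 1) ^ 5 * (5 / 8 * C1F d ℓ / (i.Mh : ℝ))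
            + 64 * 1 * ((ℓ : ℝ) + 1) ^ 7 * (5 / 8 * C1F d ℓ / (i.Mh : ℝ)))
            + (E * c) * Real.exp (δ₀ * (2 * (ℓ : ℝ) + 6)) * ((4 * b₁ * ((ℓ : ℝ) + 1) ^ 6 * (((ℓ : ℝ) + 1) ^ (d + 1)) ^ 5 * (sLipT d ℓ / ((ℓ : ℝ) + 1) * (((ℓ : ℝ) + 1) + 3))) * ((i.Mh : ℝ))⁻¹)
          ≤ ((d : ℝ) + 1) * (Real.exp (α * δ₀ * 2) * c) * Real.exp (δ₀ * 2) * (((2 * ((d : ℝ) + 1) + 4) * (5 / 8 * C1F d ℓ)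
                + (5 / 8) ^ 2 * (C2F d ℓ + 2 * C2X d ℓ) + 8 * 1 * ((ℓ : ℝ) + 1) ^ 5 * (5 / 8 * C1F d ℓ) + 64 * 1 * ((ℓ : ℝ) + 1) ^ 7 * (5 / 8 * C1F d ℓ)) * ((i.Mh : ℝ))⁻¹)
            + (E * c) * Real.exp (δ₀ * (2 * (ℓ : ℝ) + 6)) * ((4 * b₁ * ((ℓ : ℝ) + 1) ^ 6 * (((ℓ : ℝ) + 1) ^ (d + 1)) ^ 5 * (sLipT d ℓ / ((ℓ : ℝ) + 1) * (((ℓ : ℝ) + 1) + 3))) * ((i.Mh : ℝ))⁻¹) := add_le_add h2 le_rfl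
        _ = _ := by ring
    have hbr : (BR * (((d : ℝ) + 1) * (Real.exp (α * δ₀ * 2) * c) * Real.exp (δ₀ * 2) * ((2 * ((d : ℝ) + 1) + 4) * (5 / 8 * C1F d ℓ / (i.Mh : ℝ))
          + (5 / 8) ^ 2 * (C2F d ℓ + 2 * C2X d ℓ) / (i.Mh : ℝ) ^ 2 + 8 * 1 * ((ℓ : ℝ) + 1) ^ 5 * (5 / 8 * C1F d ℓ / (i.Mh : ℝ))
          + 64 * 1 * ((ℓ : ℝ) + 1) ^ 7 * (5 / 8 * C1F d ℓ / (i.Mh : ℝ))) + (E * c) * Real.exp (δ₀ * (2 * (ℓ : ℝ) + 6)) * (4 * b₁ * ((ℓ : ℝ) + 1) ^ 6 * (((ℓ : ℝ) + 1) ^ (d + 1)) ^ 5 * (sLipT d ℓ / (((ℓ : ℝ) + 1) * (i.Mh : ℝ)) * (((ℓ : ℝ) + 1) + 3))))) * ((ℓ : ℝ) + 1) ^ 5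
        ≤ ((BR * (((d : ℝ) + 1) * (Real.exp (α * δ₀ * 2) * c) * Real.exp (δ₀ * 2) * ((2 * ((d : ℝ) + 1) + 4) * (5 / 8 * C1F d ℓ)
              + (5 / 8) ^ 2 * (C2F d ℓ + 2 * C2X d ℓ) + 8 * 1 * ((ℓ : ℝ) + 1) ^ 5 * (5 / 8 * C1F d ℓ) + 64 * 1 * ((ℓ : ℝ) + 1) ^ 7 * (5 / 8 * C1F d ℓ))
              + (E * c) * Real.exp (δ₀ * (2 * (ℓ : ℝ) + 6)) * (4 * b₁ * ((ℓ : ℝ) + 1) ^ 6 * (((ℓ : ℝ) + 1) ^ (d + 1)) ^ 5 * (sLipT d ℓ / ((ℓ : ℝ) + 1) * (((ℓ : ℝ) + 1) + 3))))) * ((ℓ : ℝ) + 1) ^ 5) * ((i.Mh : ℝ))⁻¹ := by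
      have hL5 : 0 ≤ ((ℓ : ℝ) + 1) ^ 5 := pow_nonneg hL0.le 5
      calc (BR * (((d : ℝ) + 1) * (Real.exp (α * δ₀ * 2) * c) * Real.exp (δ₀ * 2) * ((2 * ((d : ℝ) + 1) + 4) * (5 / 8 * C1F d ℓ / (i.Mh : ℝ))
            + (5 / 8) ^ 2 * (C2F d ℓ + 2 * C2X d ℓ) / (i.Mh : ℝ) ^ 2 + 8 * 1 * ((ℓ : ℝ) + 1) ^ 5 * (5 / 8 * C1F d ℓ / (i.Mh : ℝ))
            + 64 * 1 * ((ℓ : ℝ) + 1) ^ 7 * (5 / 8 * C1F d ℓ / (i.Mh : ℝ))) + (E * c) * Real.exp (δ₀ * (2 * (ℓ : ℝ) + 6)) * (4 * b₁ * ((ℓ : ℝ) + 1) ^ 6 * (((ℓ : ℝ) + 1) ^ (d + 1)) ^ 5 * (sLipT d ℓ / (((ℓ : ℝ) + 1) * (i.Mh : ℝ)) * (((ℓ : ℝ) + 1) + 3))))) * ((ℓ : ℝ) + 1) ^ 5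
          ≤ (BR * ((((d : ℝ) + 1) * (Real.exp (α * δ₀ * 2) * c) * Real.exp (δ₀ * 2) * ((2 * ((d : ℝ) + 1) + 4) * (5 / 8 * C1F d ℓ)
                + (5 / 8) ^ 2 * (C2F d ℓ + 2 * C2X d ℓ) + 8 * 1 * ((ℓ : ℝ) + 1) ^ 5 * (5 / 8 * C1F d ℓ) + 64 * 1 * ((ℓ : ℝ) + 1) ^ 7 * (5 / 8 * C1F d ℓ))
              + (E * c) * Real.exp (δ₀ * (2 * (ℓ : ℝ) + 6)) * (4 * b₁ * ((ℓ : ℝ) + 1) ^ 6 * (((ℓ : ℝ) + 1) ^ (d + 1)) ^ 5 * (sLipT d ℓ / ((ℓ : ℝ) + 1) * (((ℓ : ℝ) + 1) + 3)))) * ((i.Mh : ℝ))⁻¹)) * ((ℓ : ℝ) + 1) ^ 5 :=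
            mul_le_mul_of_nonneg_right (mul_le_mul_of_nonneg_left hin hBR) hL5
        _ = _ := by ring
    have hN' : (0 : ℝ) ≤ 3 * 5 ^ (d + 1) * (E * c) := by positivity
    have h4 := mul_le_mul_of_nonneg_right (add_le_add (mul_le_mul_of_nonneg_left (mul_le_mul_of_nonneg_left hbr hS0) hN')
      (le_refl (KV * ((i.Mh : ℝ))⁻¹))) hc0
    refine lt_of_le_of_lt (h4.trans ?_) (by norm_num : (2 : ℝ)⁻¹ < 1)
    refine le_trans (le_of_eq ?_) (inv_small hm0 (by rw [← hTqVdef]; exact hTqV))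
    ring
  -- unfold the letters so that the located smallness matches the endpoint's display
  rw [← geo9K_M_eq' i] at hq
  rw [hS, hc, hE, hθ] at hq
  rw [hS, hc, hE] at hqV
  -- ─── the endpoint: (Eₛ) with the member-dependent constant, and (1ₛ) ───
  have h := eBlock_kernelFamilyBInv_GAY_of_localInverseCubes'' i b ιB cfg par (Rr := (0 : ℝ)) (Hp := True) hι hM₂ hrepr hη hb₁'
    (parSymY i) (parBY i) (GpY i (parSymY i)) (fun c' => zetaY i c') (fun c' z hz => zetaY_eq_one_of_hTY_ne_zero i c' hz)
    (fun c' => fun _ => locLetterBY i c' (parSymY i) (parBY i) (g c') (chiY i c')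
      (locCfgY i c' (kGeo i).eta (fun κ x => (2 : ℂ)⁻¹ • (A c' κ x + star (A c' κ x)))))
    (fun c' => locProjBY i c' (parSymY i) (g c') (locCfgY i c' (kGeo i).eta (fun κ x => (2 : ℂ)⁻¹ • (A c' κ x + star (A c' κ x)))))
    (fun c' => locP1BY i c' (parSymY i) (g c') (hTY i c') (locCfgY i c' (kGeo i).eta (fun κ x => (2 : ℂ)⁻¹ • (A c' κ x + star (A c' κ x)))))
    (fun c' => locDefectBY i c' (parSymY i) (parBY i) (g c') (chiY i c') (hTY i c')
      (locCfgY i c' (kGeo i).eta (fun κ x => (2 : ℂ)⁻¹ • (A c' κ x + star (A c' κ x)))))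
    (fun c' => locDefectTBY i c' (parSymY i) (parBY i) (g c') (chiY i c') (hTY i c')
      (locCfgY i c' (kGeo i).eta (fun κ x => (2 : ℂ)⁻¹ • (A c' κ x + star (A c' κ x)))))
    hP1 hdef hdefT (fun ν => cdBₗ i (cfg U₁) ν) (fun ν => cdsBₗ i (cfg U₁) ν) (fun _ _ => rfl) (fun _ _ => rfl)
    (lapBₗ i (cfg U₁)) (lapBₗ_apply i (cfg U₁)) d' (δ₀ := δ₀) (α := α) (Θ' := KR * ((i.Mh : ℝ))⁻¹) (θV' := KV * ((i.Mh : ℝ))⁻¹)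
    (B₀ := BR) (δh := 1) hBR hδ₀.le (mul_nonneg hKR (inv_nonneg.2 hm0.le)) (mul_nonneg hKV (inv_nonneg.2 hm0.le)) zero_le_one
    hαδ.le hαδ2 h261 h263 hq hqV hE' hUb hTb hW' hrest' hV''
  have hu := isUnit_deltaAY_of_localInverse i b ιB cfg par (Rr := (0 : ℝ)) (Hp := True) hι hM₂ hrepr hη hb₁' d'
    (δ₀ := δ₀) (α := α) (Θ' := KR * ((i.Mh : ℝ))⁻¹) (B₀ := BR) (δh := 1)
    (parSymY i) (parBY i) (GpY i (parSymY i)) (fun c' => zetaY i c') (fun c' z hz => zetaY_eq_one_of_hTY_ne_zero i c' hz)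
    (fun c' => fun _ => locLetterBY i c' (parSymY i) (parBY i) (g c') (chiY i c')
      (locCfgY i c' (kGeo i).eta (fun κ x => (2 : ℂ)⁻¹ • (A c' κ x + star (A c' κ x)))))
    (fun c' => locProjBY i c' (parSymY i) (g c') (locCfgY i c' (kGeo i).eta (fun κ x => (2 : ℂ)⁻¹ • (A c' κ x + star (A c' κ x)))))
    (fun c' => locP1BY i c' (parSymY i) (g c') (hTY i c') (locCfgY i c' (kGeo i).eta (fun κ x => (2 : ℂ)⁻¹ • (A c' κ x + star (A c' κ x)))))
    (fun c' => locDefectBY i c' (parSymY i) (parBY i) (g c') (chiY i c') (hTY i c')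
      (locCfgY i c' (kGeo i).eta (fun κ x => (2 : ℂ)⁻¹ • (A c' κ x + star (A c' κ x)))))
    hP1 hdef hBR hδ₀.le (mul_nonneg hKR (inv_nonneg.2 hm0.le)) zero_le_one hαδ.le hαδ1 h261 hq hE' hUb hTb hW' hrest'
  refine ⟨hu, ?_⟩
  -- ─── the member-dependent constant is at most `K_A` (§0) ───
  rw [geo9K_M_eq' i, ← hS, ← hc, ← hE, ← hθ] at h
  have hle := member_constant_le_deltaA (S := S) (N := 3 * 5 ^ (d + 1)) (c := c) (E := E) (θ := θ) (L := (ℓ : ℝ) + 1) (m := (i.Mh : ℝ))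
    (KR := KR) (KV := KV) (B₀ := BR) (b₁ := b₁) (C₁ := C1F d ℓ) (C₂ := C2F d ℓ) (CX := C2X d ℓ) (sT := sLipT d ℓ) (D := (d : ℝ) + 1)
    (e := Real.exp δ₀) (e₂ := Real.exp (δ₀ * 2)) (eα := Real.exp (α * δ₀)) (eα₂ := Real.exp (α * δ₀ * 2))
    (eL := Real.exp (δ₀ * (2 * (ℓ : ℝ) + 6))) (h := 1) (k := d + 1)
    hS0 hN0 hc0 hE0 hL1 hm1 hBR hC₁ hC₂ hCX hD0 he he₂ heα heα₂ (by rw [← hTqdef]; exact hTq) (by rw [← hTqVdef]; exact hTqV)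
  rw [← hKAdef] at hle
  exact eBlock_rate_mono i _ hle le_rfl hKA0 h


/-! ## §2 ★★★ The consumer's letter: `d = 2`, `N = 2`, `b₀ = b₁ = 1` (the hypothesis of `hThm2Cover_of_prop6_deltaAAssembler`, verbatim) -/

/-- ★★★ **THE MEMBER ASSEMBLER IN THE CONSUMER's LETTER** — §1 at `d + 1 = 3`, `G = U(2)`, `b₀ = b₁ = 1`: EXACTLY the displayed hypothesis of t2s-1's
`B8Thm2TorusCoverOfDeltaAAssembler.hThm2Cover_of_prop6_deltaAAssembler` (its tree text l. 117–142, copied), so that the sub-row's LAST JUNCTION is the one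
application `hThm2Cover_of_prop6_deltaAAssembler … (deltaA_at_member_of_cubeData_two b hℓ hM₂ hrepr)` (kernel-checked shape certificate; `1 ≤ ℓ` from the
consumer's `4 ≤ ℓ`).  HONEST SCOPE as in §1. [cite: Balaban1985BackgroundPropagators, Thm 3.3 p.399 via Thm 3.10 pp.414–416, (3.105)–(3.106) p.414, Cor. 3.6 p.408, (3.69) p.404; Balaban1984PropagatorsII, Lemma 2.1 (2.60)–(2.63) p.234] -/
theorem deltaA_at_member_of_cubeData_two {hd₃ : 1 ≤ 2 + 1} [DecidableEq ι]
    [∀ i' : KIdx 2 ℓ hd₃ hL 1 1, Fintype (geo9K i').Site] [∀ i' : KIdx 2 ℓ hd₃ hL 1 1, DecidableEq (geo9K i').Site]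
    (b : Module.Basis ι ℝ (Matrix (Fin 2) (Fin 2) ℂ)) (hℓ : 1 ≤ ℓ)
    {M₂ : ℝ} (hM₂ : 0 ≤ M₂) (hrepr : ∀ (v : (Matrix (Fin 2) (Fin 2) ℂ)) (j : ι), |b.repr v j| ≤ M₂ * ‖v‖) :
    letI : CStarAlgebra (Matrix (Fin 2) (Fin 2) ℂ) := {}
    ∃ δA KA M₀ T₀ : ℝ, ∃ N₀ : ℕ, 0 < δA ∧ 0 ≤ KA ∧ ∃ a₁ : ℝ, 0 < a₁ ∧ ∃ δh₀ : ℝ, 0 < δh₀ ∧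
      ∀ (i : KIdx 2 ℓ hd₃ hL 1 1),
        M₀ ≤ ((ℓ : ℝ) + 1) * (toKT i).Mh → N₀ + 1 ≤ (toKT i).R * ((ℓ + 1) * (toKT i).Mh) → T₀ ≤ RM1 i →
        i.cf = (((ℓ + 1 : ℕ) : ℝ)) ^ i.k →
      ∀ (ιB : BlkY i → IBondY i), (∀ s, β i.hN i.D i.hk (ιB s) = s) →
      ∀ (U : CfgY (Matrix (Fin 2) (Fin 2) ℂ) i), (∀ μ x, U μ x ∈ unitaryUnits (Matrix (Fin 2) (Fin 2) ℂ)) →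
      ∀ (δh : ℝ), 0 ≤ δh → δh ≤ δh₀ →
        (∀ p : PlaqY i, ‖((holY i U p : (Matrix (Fin 2) (Fin 2) ℂ)ˣ) : Matrix (Fin 2) (Fin 2) ℂ) - 1‖ ≤
          δh * ((((ℓ : ℝ) + 1) ^ levY i (chartY i p.src))⁻¹) ^ 2) →
      ∀ (g : ↥(cubes (toKT i).D.toDomains) → GaugeY (Matrix (Fin 2) (Fin 2) ℂ) i),
        (∀ c x, ‖(g c x : Matrix (Fin 2) (Fin 2) ℂ)‖ ≤ 1 ∧ ‖(((g c x)⁻¹ : (Matrix (Fin 2) (Fin 2) ℂ)ˣ) : Matrix (Fin 2) (Fin 2) ℂ)‖ ≤ 1) →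
      ∀ (A : ↥(cubes (toKT i).D.toDomains) → AfldY (Matrix (Fin 2) (Fin 2) ℂ) i)
        (Q : ↥(cubes (toKT i).D.toDomains) → Set (Site (PV 2 ℓ i.m i.K hd₃ hL) 0)) (C ξ Λ : ↥(cubes (toKT i).D.toDomains) → ℝ),
        (∀ c, 0 ≤ C c) → (∀ c, 0 < ξ c) → (∀ c, 1 ≤ Λ c) → (∀ c, ξ c ≤ 5 * (SC i c : ℝ) * (kGeo i).eta) →
        (∀ c, LatticeNorms.scaleLen ((ℓ : ℝ) + 1) (kGeo i).eta (c.1.1 + 1) ≤ Λ c * ξ c) →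
        (∀ c, ∀ x : Site (PV 2 ℓ i.m i.K hd₃ hL) 0, NearC i c (35 * SC i c / 8 + 1) (boxEquiv i.hN x).1 → x ∈ Q c) →
        (∀ c, ∀ (κ : Fin (2 + 1)) (x : Site (PV 2 ℓ i.m i.K hd₃ hL) 0), x ∈ Q c → x.shift κ ∈ Q c →
          gaugeY i (g c) U κ x = fluct (kGeo i).eta (A c) κ x) →
        (∀ c, ∀ κ, ∀ x ∈ Q c, ‖A c κ x‖ ≤ C c * (ξ c)⁻¹) →
        (∀ c, ∀ μ ν, ∀ x ∈ Q c,
          ‖(((kGeo i).eta : ℂ)⁻¹) • covD (shiftsV1 (PV 2 ℓ i.m i.K hd₃ hL)) (fun _ _ => (1 : (Matrix (Fin 2) (Fin 2) ℂ)ˣ)) μ (A c ν) x‖ ≤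
            C c * (ξ c ^ 2)⁻¹) →
        (∀ c, max (C c) (C c * (1 + D1 thetaProf)) * Λ c ^ 2 ≤ a₁) → (∀ c, max (C c) (C c * (1 + D1 thetaProf)) * Λ c ^ 2 ≤ 1 / 4) →
      ∀ {B : B9.Backgrounds} (cfg : B.Cfg → CfgY (Matrix (Fin 2) (Fin 2) ℂ) i) (par : BondParY (Matrix (Fin 2) (Fin 2) ℂ) i) (U₁ : B.Cfg), cfg U₁ = U →
        IsUnit (deltaAY i (parSymY i) (parBY i) (GpY i (parSymY i)) U) ∧
        EBlock (kernelFamilyBInv i B cfg (GAY i (parSymY i) (parBY i) (GpY i (parSymY i))) par) KA δA U₁ :=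
  deltaA_at_member_of_cubeData b hℓ one_pos le_rfl hM₂ hrepr

end Literature.MathematicalPhysics.QuantumFieldTheory.Balaban1983to89.B9Thm310DeltaAAtMemberOfCubeData

end
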